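import Summits.CriticalPhenomena.CardyFormulaZ2.Theses.CardyBoundaryCoulombGas
import Summits.CriticalPhenomena.CardyFormulaZ2.Theses.CardyTotalPositivity
import Summits.CriticalPhenomena.CardyFormulaZ2.Theorems.CardyBoundaryCoulombGasHalfPlaneOneArmThirdIpRecursionOfFact
import Summits.CriticalPhenomena.CardyFormulaZ2.Theorems.CardyBoundaryCoulombGasHalfPlaneOneArmThirdRecursionExponent
import Summits.CriticalPhenomena.CardyFormulaZ2.Theorems.CardyBoundaryCoulombGasHalfPlaneOneArmThirdPassageLeArm
import Summits.CriticalPhenomena.CardyFormulaZ2.Theorems.CardyBoundaryCoulombGasHalfPlaneOneArmThirdArmLePassage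
import Summits.CriticalPhenomena.CardyFormulaZ2.Theorems.CardyBoundaryCoulombGasHalfPlaneOneArmThirdRotationTransfer

/-!
# `HalfPlaneOneArmThird` (β₁⁺(bond ℤ², p = 1/2) = 1/3) from Ikhlef–Ponsaing Prop. 4.7 and DKKMO Cor. 1.3

Crux `stmt-CriticalPhenomena-5662`, route decl
`Summit.CriticalPhenomena.CardyFormulaZ2.Theses.CardyBoundaryCoulombGas.HalfPlaneOneArmThird`
(shared verbatim with `CardyTotalPositivity.HalfPlaneOneArmThird`): for bond percolation on `ℤ²`
at `p = 1/2`, `log P[0 ↔ {y₀ = ±n} ∪ {y₁ = n} inside [-n,n]×[0,n]] / log n → -1/3` — the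
half-plane one-arm exponent of bond-`ℤ²` exists and equals `1/3` (a theorem only on site-`𝕋`,
Smirnov–Werner 2001; open on `ℤ²`).

This file assembles line `ip-passage-stirling` (lead `prover-line-stmt-CriticalPhenomena-5662-0`,
skeleton `Cruxes/HalfPlaneOneArmThird/Lines/ip-passage-stirling.lean`) from its five LANDED stubs
(`Theorems/CardyBoundaryCoulombGasHalfPlaneOneArmThird{IpRecursionOfFact, RecursionExponent,
PassageLeArm, ArmLePassage, RotationTransfer}.lean`, namespace
`Summit.CriticalPhenomena.CardyFormulaZ2.Cruxes.HalfPlaneOneArmThird.IpPassageStirling`) into the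
honest CONDITIONAL theorem

* `HalfPlaneOneArmThird_of_ikhlefPonsaing_of_dkkmo :
    IkhlefPonsaingFirstPassage → dkkmo_crossing_rotation_invariance → HalfPlaneOneArmThird`,

resting on exactly two published results held in the tree as (unproved) named facts:
`Literature.Probability.Percolation.IkhlefPonsaingFirstPassage` (Ikhlef–Ponsaing, J. Stat. Phys.
149 (2012), arXiv:1202.5476, Prop. 4.7: the exact wall-passage probability
`P_b(2m+1) = A_V(2m+1)A_V(2m+3)/N_8(2m+2)²` of the diagonal wired/free strip) and
`Literature.Probability.Percolation.dkkmo_crossing_rotation_invariance` (Duminil-Copin–Kozlowski–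
Krachun–Manolescu–Oulamara, arXiv:2012.11672, Cor. 1.3 at `q = 1`: rotation invariance of quad
crossing probabilities). Everything else — the factorial-product bridge to the two-step recursion,
the Gamma-free `-1/3` asymptotics of that recursion, the matched-scale dictionary between the strip
passage and the diagonal half-plane arm (first exit; Harris–FKG gluing of turned RSW boxes), and the
orientation transfer (half-plane one-arm quasi-multiplicativity in both orientations, half-annulus
quads and their lattice shadows, `Literature/Probability/Percolation/HalfPlaneArm*`,
`HalfAnnulusQuad*`, `ArmExponentOrientationTransfer`) — is proved. Also recorded: the DKKMO-free
half, `diagArm_exponent_of_ikhlefPonsaing` (IP Prop. 4.7 alone gives the DIAGONAL half-plane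
one-arm exponent `1/3`, existence of the limit included), and the shared copy on route
`CardyTotalPositivity`.

Composition: S1a+fact give the recursion `P_b(2m+3)(3m+4)(4m+7)(6m+5) = P_b(2m+1)(3m+5)(4m+3)(6m+7)`,
hence `P_b > 0` from `P_b(1) = 1` and (S2) `log P_b(2n+1)/log n → -1/3`; S3+S4 sandwich
`log P_b(2n+1) ≤ log π◇(n) ≤ log P_b(2n+1) - log c`, so `log π◇(n)/log n → -1/3`; S5 (fed with the
DKKMO fact) subtracts `(log π◇(n) - log π⁺(n))/log n → 0`. No definition is introduced: the three
probabilities are written inline over tree vocabulary (`bondPercolation`, `zdGraph`, `half`,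
`openConnIn`, `Site`), exactly as in the registered stubs.
-/

noncomputable section

namespace Summit.CriticalPhenomena.CardyFormulaZ2.Theorems

open Filter Topology
open Literature.Probability.Percolation Literature.Probability.LatticeModels
open Summit.CriticalPhenomena.CardyFormulaZ2.Cruxes.HalfPlaneOneArmThird.IpPassageStirling

/-- `K / log n → 0` along the naturals. -/
theorem halfPlaneOneArmThird_tendsto_const_div_log (K : ℝ) :
    Tendsto (fun n : ℕ ↦ K / Real.log n) atTop (𝓝 0) :=
  tendsto_const_nhds.div_atTop (Real.tendsto_log_atTop.comp tendsto_natCast_atTop_atTop)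

/-- **The DKKMO-free half (conditional on Ikhlef–Ponsaing Prop. 4.7 only): the DIAGONAL half-plane
one-arm exponent of bond-`ℤ²` at `p = 1/2` exists and equals `1/3`.** In diagonal coordinates
`s = v₀+v₁`, `d = v₀-v₁`: `log P[0 ↔ {s = -n} ∪ {d = ±n} inside {-n ≤ s ≤ 1, |d| ≤ n}] / log n → -1/3`.
From the fact: recursion (S1a), positivity, `-1/3` asymptotics (S2), and the matched-scale sandwich
`c·π◇(n) ≤ P_b(2n+1) ≤ π◇(n)` (S4, S3). -/
theorem diagArm_exponent_of_ikhlefPonsaing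
    (hIP : Literature.Probability.Percolation.IkhlefPonsaingFirstPassage) :
    Tendsto (fun n : ℕ ↦
      Real.log ((bondPercolation (zdGraph 2) half).real
        {ω | ∃ y : Site 2, (y 0 + y 1 = -(n : ℤ) ∨ y 0 - y 1 = (n : ℤ) ∨ y 0 - y 1 = -(n : ℤ)) ∧
          ω ∈ openConnIn {v : Site 2 | v 0 + v 1 ≤ 1 ∧ -(n : ℤ) ≤ v 0 + v 1 ∧
            -(n : ℤ) ≤ v 0 - v 1 ∧ v 0 - v 1 ≤ n} 0 y}) / Real.log n) atTop (𝓝 (-(1 / 3 : ℝ))) := by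
  -- the wall-passage probability `P_b(2m+1)` and the diagonal arm probability `π◇(n)`, inline
  let W : ℕ → ℝ := fun m ↦ (bondPercolation (zdGraph 2) half).real
    {ω | ∃ y : Site 2, y 0 + y 1 = 0 ∧
      ω ∈ openConnIn {v : Site 2 | 0 ≤ v 0 + v 1 ∧ v 0 + v 1 ≤ 2 * (m : ℤ) + 1} ![2 * (m : ℤ), 0] y}
  let D : ℕ → ℝ := fun n ↦ (bondPercolation (zdGraph 2) half).real
    {ω | ∃ y : Site 2, (y 0 + y 1 = -(n : ℤ) ∨ y 0 - y 1 = (n : ℤ) ∨ y 0 - y 1 = -(n : ℤ)) ∧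
      ω ∈ openConnIn {v : Site 2 | v 0 + v 1 ≤ 1 ∧ -(n : ℤ) ≤ v 0 + v 1 ∧
        -(n : ℤ) ≤ v 0 - v 1 ∧ v 0 - v 1 ≤ n} 0 y}
  -- S1a + fact: the recursion
  have hrec : ∀ m : ℕ, W (m + 1) * ((3 * (m : ℝ) + 4) * (4 * (m : ℝ) + 7) * (6 * (m : ℝ) + 5)) =
      W m * ((3 * (m : ℝ) + 5) * (4 * (m : ℝ) + 3) * (6 * (m : ℝ) + 7)) :=
    fun m ↦ stub_ipRecursion_of_ikhlefPonsaing hIP m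
  -- `P_b(1) = 1`: the site `(0,0)` lies on the wired row
  have hW0 : W 0 = 1 := by
    have hmem : (![2 * ((0 : ℕ) : ℤ), 0] : Site 2) ∈
        {v : Site 2 | 0 ≤ v 0 + v 1 ∧ v 0 + v 1 ≤ 2 * ((0 : ℕ) : ℤ) + 1} := by simp
    show (bondPercolation (zdGraph 2) half).real _ = 1
    convert MeasureTheory.probReal_univ (μ := bondPercolation (zdGraph 2) half) using 2
    refine Set.eq_univ_of_forall fun ω => ⟨![2 * ((0 : ℕ) : ℤ), 0], by simp, ?_⟩
    exact ⟨hmem, hmem, SimpleGraph.Reachable.refl _⟩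
  -- positivity of `P_b`
  have hWpos : ∀ m : ℕ, 0 < W m := by
    intro m
    induction m with
    | zero => rw [hW0]; exact one_pos
    | succ m ih =>
      have hD : (0 : ℝ) < (3 * (m : ℝ) + 4) * (4 * (m : ℝ) + 7) * (6 * (m : ℝ) + 5) := by positivity
      have hN : (0 : ℝ) < (3 * (m : ℝ) + 5) * (4 * (m : ℝ) + 3) * (6 * (m : ℝ) + 7) := by positivity
      have hprod : 0 < W (m + 1) * ((3 * (m : ℝ) + 4) * (4 * (m : ℝ) + 7) * (6 * (m : ℝ) + 5)) := by
        rw [hrec m]; exact mul_pos ih hN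
      exact (mul_pos_iff_of_pos_right hD).mp hprod
  -- S2: the exponent of `P_b`
  have hA : Tendsto (fun n : ℕ ↦ Real.log (W n) / Real.log n) atTop (𝓝 (-(1 / 3 : ℝ))) :=
    stub_recursionExponent W hW0 hrec
  -- S3, S4: the sandwich
  have h₃ : ∀ n : ℕ, 1 ≤ n → W n ≤ D n := fun n hn ↦ stub_passageLeArm n hn
  obtain ⟨c, hc, h₄⟩ := stub_armLePassage
  have hup : Tendsto (fun n : ℕ ↦ (Real.log (W n) - Real.log c) / Real.log n) atTop
      (𝓝 (-(1 / 3 : ℝ))) := by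
    have h := hA.sub (halfPlaneOneArmThird_tendsto_const_div_log (Real.log c))
    rw [sub_zero] at h
    refine h.congr' (Eventually.of_forall fun n => ?_)
    simp only [sub_div]
  refine tendsto_of_tendsto_of_tendsto_of_le_of_le' hA hup ?_ ?_
  · filter_upwards [eventually_ge_atTop 2] with n hn
    have hn' : (2 : ℝ) ≤ n := by exact_mod_cast hn
    have hlog : 0 < Real.log n := Real.log_pos (by linarith)
    have hle : W n ≤ D n := h₃ n (by omega)
    exact div_le_div_of_nonneg_right (Real.log_le_log (hWpos n) hle) hlog.le
  · filter_upwards [eventually_ge_atTop 2] with n hn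
    have hn' : (2 : ℝ) ≤ n := by exact_mod_cast hn
    have hlog : 0 < Real.log n := Real.log_pos (by linarith)
    have hle : c * D n ≤ W n := h₄ n (by omega)
    have hdpos : 0 < D n := lt_of_lt_of_le (hWpos n) (h₃ n (by omega))
    have hle' : D n ≤ W n / c := by
      rw [le_div_iff₀ hc, mul_comm]; exact hle
    have hlogle := Real.log_le_log hdpos hle'
    rw [Real.log_div (hWpos n).ne' hc.ne'] at hlogle
    exact div_le_div_of_nonneg_right hlogle hlog.le

/-- **`HalfPlaneOneArmThird` from the two named facts** (line `ip-passage-stirling`, fully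
assembled): Ikhlef–Ponsaing Prop. 4.7 (`IkhlefPonsaingFirstPassage`) and DKKMO Cor. 1.3 at `q = 1`
(`dkkmo_crossing_rotation_invariance`) imply that the half-plane one-arm exponent of bond
percolation on `ℤ²` at `p = 1/2` exists and equals `1/3`:
`log P_{1/2}[0 ↔ ∂([-n,n]×[0,n]) inside the half-box] / log n → -1/3`. CONDITIONAL on the two facts
(both published theorems, vendored unproved); all other steps are kernel-checked tree theorems. -/
theorem HalfPlaneOneArmThird_of_ikhlefPonsaing_of_dkkmo
    (hIP : Literature.Probability.Percolation.IkhlefPonsaingFirstPassage)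
    (hDK : Literature.Probability.Percolation.dkkmo_crossing_rotation_invariance) :
    Summit.CriticalPhenomena.CardyFormulaZ2.Theses.CardyBoundaryCoulombGas.HalfPlaneOneArmThird := by
  have hB := diagArm_exponent_of_ikhlefPonsaing hIP
  have h₅ := stub_rotationTransfer hDK
  have hC := hB.sub h₅
  rw [sub_zero] at hC
  show Tendsto _ atTop (𝓝 (-(1 / 3 : ℝ)))
  refine hC.congr' ?_
  filter_upwards [eventually_ge_atTop 2] with n hn
  have hn' : (2 : ℝ) ≤ n := by exact_mod_cast hn
  have hlog : Real.log n ≠ 0 := (Real.log_pos (by linarith)).ne'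
  field_simp
  ring

/-- The shared copy of the crux on route `CardyTotalPositivity` (same proposition), from the same
two named facts. -/
theorem CardyTotalPositivity_HalfPlaneOneArmThird_of_ikhlefPonsaing_of_dkkmo
    (hIP : Literature.Probability.Percolation.IkhlefPonsaingFirstPassage)
    (hDK : Literature.Probability.Percolation.dkkmo_crossing_rotation_invariance) :
    Summit.CriticalPhenomena.CardyFormulaZ2.Theses.CardyTotalPositivity.HalfPlaneOneArmThird :=
  HalfPlaneOneArmThird_of_ikhlefPonsaing_of_dkkmo hIP hDK

end Summit.CriticalPhenomena.CardyFormulaZ2.Theorems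

end
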